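import Summits.ValiantsHypothesis.ValiantsHypothesis.Theorems.ImmanantSliceEvenCycleDominance
import Literature.Computability.AlgebraicComplexity.ValiantConjectureEquivProofs

/-!
# Route ImmanantSlice — support item `EvenCycleCoverNotVP` (stmt-ValiantsHypothesis-4214): status

`EvenCycleCoverNotVP` (the signed even-cycle-cover family `D^even` is not in `VP_ℂ`) was filed as
the route's kill switch ("so that its REFUTATION has a decl to close"). With the crux
`EvenCycleDominance` now PROVED (`evenCycleDominance_proof`: `D^even ∈ VP ⇒ per p-computable`)
its status is pinned to the summit:

* `evenCycleCoverNotVP_of_valiantsHypothesis` — `VP_ℂ ≠ VNP_ℂ ⇒ EvenCycleCoverNotVP`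
  (Valiant's hypothesis over `ℂ` is `per ∉ VP`, `perNotPComputableComplex_iff_holds`);
* `not_valiantsHypothesis_of_not_evenCycleCoverNotVP` — contrapositive: a refutation of the kill
  switch (a polynomial-size circuit family for `D^even`) would refute `VP ≠ VNP` itself.

So the item is exactly as hard to refute as the summit and follows from it; it is NOT proved here
(that would be `VP ≠ VNP`). Honest framing: bookkeeping; nothing here bears on VP ≠ VNP.
-/

noncomputable section

-- the summit and the problem share the name `ValiantsHypothesis` (D-0017 single-conjunct layout)
set_option linter.dupNamespace false

namespace Summit.ValiantsHypothesis.ValiantsHypothesis.Theorems.ImmanantSlice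

open Literature.Computability.AlgebraicComplexity

/-- **`VP ≠ VNP ⇒ EvenCycleCoverNotVP`.** If `D^even` were a `VP` family, the proved crux
`EvenCycleDominance` would make the permanent p-computable, i.e. `VP_ℂ = VNP_ℂ`
(`perNotPComputableComplex_iff_holds`, Valiant 1979 / Bürgisser 2000 Rem. 2.11). -/
theorem evenCycleCoverNotVP_of_valiantsHypothesis (hV : _root_.ValiantsHypothesis) :
    Theses.ImmanantSlice.EvenCycleCoverNotVP := by
  intro hVP
  exact (perNotPComputableComplex_iff_holds.mpr hV) (evenCycleDominance_proof hVP)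

/-- Contrapositive: refuting the kill switch `EvenCycleCoverNotVP` (exhibiting `D^even ∈ VP`)
refutes Valiant's hypothesis `VP_ℂ ≠ VNP_ℂ`. -/
theorem not_valiantsHypothesis_of_not_evenCycleCoverNotVP
    (h : ¬ Theses.ImmanantSlice.EvenCycleCoverNotVP) : ¬ _root_.ValiantsHypothesis :=
  fun hV => h (evenCycleCoverNotVP_of_valiantsHypothesis hV)

end Summit.ValiantsHypothesis.ValiantsHypothesis.Theorems.ImmanantSlice
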